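import Summits.ResolutionOfSingularities.ResolutionOfSingularities.Theorems.FrobeniusLadderFInjectiveMacaulayficationToricChartFedderAssembly
import HarnessLib

/-!
# (C2ᶜⁱ) The toric chart transfer of the PRODUCT certificate (complete intersections)

Support file for crux stmt-ResolutionOfSingularities-15315 (`FrobeniusLadder.FInjectiveMacaulayfication`), chain w45a, seat
res-L1-w45a-stub-6 (res-D-pv-018, D→L convert), file 5 of the CI-CN engine (idea-1 card 4 `f-torific-key-reembedding`,
`Sketch-L1-idea-1.lean` r4 §9 (C2ᶜⁱ) `ciToricChartFedder`, statement verbatim modulo namespace). [OURS · L1 W4.5a] — NOT a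
statement of the manuscript [claim: Hironaka2017]; AI-written, weaker than expert review.

ONE EMBEDDING CODIMENSION UP from stub-1's `ToricChartFedderAssembly.toricChart_fedder` (p490448): data `V` unimodular,
`θ : X_j ↦ ∏ᵢ Yᵢ ^ V i j`, `θ F_l = Y^(d_l) · g_l` for every `l : Fin r`, a `K`-point `a` with vanishing chart coordinates `S ≠ ∅`
at which ALL `g_l` vanish, face compatibility for every `F_l`, and the CI FACE CERTIFICATE for the weight `w_S = Σ_{i∈S} vᵢ`:
Fedder's test for the PRODUCT `∏_l in_S F_l` of the initial forms at every torus point where all of them vanish (over every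
field extension). Conclusion: the product `∏_l g_l` passes Fedder's test `(∏ g_l)^(p-1) ∉ ((Yᵢ - aᵢ)^p)` at `a`.

The chain is stub-1's, applied to the product (`θ` and `Y_S ↦ 0` are ring homomorphisms, so B1–B4 pass through `∏`):
`Σ_{i∈S} d_l i` is the initial degree of `F_l` (B4 `ToricChartFedder.isInitialDegree_face`) and
`Y^(d_l) · g_l(Y_S = 0) = θ(in_S F_l)` (`…monomial_mul_substZero_eq_theta_component`), hence
`(∏ Y^(d_l)) · ∏ g_l(Y_S=0) = θ(∏ in_S F_l)`; at the torus point `ã` (`1` on `S`, `a` off `S`) with image `b = ã^V` every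
`in_S F_l` vanishes (because `g_l(a) = 0`), the certificate gives Fedder for `∏ in_S F_l` at `b`, B3
`MonomialChartFrobeniusTransport.fedder_monomialChart_of_fedder` moves it to `ã`, B2 `FedderPointReductions` removes
`∏ Y^(d_l)`, B1 moves `∏ g_l(Y_S = 0)` from `ã` to `a` and lifts to `∏ g_l`.

No definitions, no named facts; glue. [folklore; cite: Fedder1983, Prop. 1.7 (the test)]
-/

-- single-problem summit: the doubled namespace component is forced
set_option linter.dupNamespace false

noncomputable section

namespace Summit.ResolutionOfSingularities.ResolutionOfSingularities.Theorems.FInjectiveMacaulayfication.CIToricChartFedder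

open MvPolynomial
open Summit.ResolutionOfSingularities.ResolutionOfSingularities.Theorems.FInjectiveMacaulayfication

/-- Initial degrees are unique: two degrees `D`, `D'` with «component non-zero, all lower components zero» coincide.
[folklore] -/
theorem initialDegree_unique {n : ℕ} {k : Type} [CommSemiring k] (w : Fin n → ℕ) (f : MvPolynomial (Fin n) k)
    {D D' : ℕ}
    (hD : weightedHomogeneousComponent w D f ≠ 0 ∧ ∀ D'' < D, weightedHomogeneousComponent w D'' f = 0)
    (hD' : weightedHomogeneousComponent w D' f ≠ 0 ∧ ∀ D'' < D', weightedHomogeneousComponent w D'' f = 0) :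
    D = D' := by
  rcases lt_trichotomy D D' with h | h | h
  · exact absurd (hD'.2 D h) hD.1
  · exact h
  · exact absurd (hD.2 D' h) hD'.1

/-- **(C2ᶜⁱ) THE TORIC CHART TRANSFER OF THE PRODUCT CERTIFICATE** (idea-1 `Sketch-L1-idea-1.lean` r4 §9
`ciToricChartFedder`, verbatim): `V` unimodular, `θ F_l = y^(d_l) · g_l` for every `l`, a point `a` of the chart with zero set
`S ≠ ∅` of its coordinates, the `w_S`-initial degrees `D l`, a common minimiser of the rows `i ∈ S` on each `supp F_l`. If
`(∏_l in_S F_l)^(p-1) ∉ ((X - b)^[p])` at every torus point `b` (over every field extension) where ALL `in_S F_l` vanish, and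
all `g_l(a) = 0`, then `(∏_l g_l)^(p-1) ∉ ((y - a)^[p])`. [folklore; cite: Fedder1983, Prop. 1.7 (the test)] -/
theorem ciToricChartFedder : ∀ (p : ℕ) [Fact p.Prime] (n r : ℕ) (k : Type) [Field k] [CharP k p]
    (F : Fin r → MvPolynomial (Fin n) k) (V : Matrix (Fin n) (Fin n) ℕ), IsUnit (V.map (Nat.cast : ℕ → ℤ)).det →
    ∀ (d : Fin r → (Fin n →₀ ℕ)) (g : Fin r → MvPolynomial (Fin n) k),
    (∀ l, MvPolynomial.aeval (fun j : Fin n => ∏ i : Fin n, (MvPolynomial.X i : MvPolynomial (Fin n) k) ^ V i j) (F l) =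
      MvPolynomial.monomial (d l) 1 * g l) →
    ∀ (K : Type) [Field K] [CharP K p] [Algebra k K] (a : Fin n → K) (S : Finset (Fin n)),
    (∀ i, i ∈ S ↔ a i = 0) → S.Nonempty →
    ∀ (D : Fin r → ℕ),
    (∀ l, MvPolynomial.weightedHomogeneousComponent (fun j : Fin n => ∑ i ∈ S, V i j) (D l) (F l) ≠ 0 ∧
        ∀ D' < D l, MvPolynomial.weightedHomogeneousComponent (fun j : Fin n => ∑ i ∈ S, V i j) D' (F l) = 0) →
    (∀ (K' : Type) [Field K'] [Algebra k K'] (b : Fin n → K'), (∀ i, b i ≠ 0) →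
        (∀ l, MvPolynomial.aeval b (MvPolynomial.weightedHomogeneousComponent (fun j : Fin n => ∑ i ∈ S, V i j) (D l) (F l)) = 0) →
        (∏ l, MvPolynomial.map (algebraMap k K')
            (MvPolynomial.weightedHomogeneousComponent (fun j : Fin n => ∑ i ∈ S, V i j) (D l) (F l))) ^ (p - 1) ∉
          Ideal.span (Set.range fun i : Fin n => (MvPolynomial.X i - MvPolynomial.C (b i)) ^ p)) →
    (∀ l, ∃ m ∈ (F l).support, ∀ i ∈ S, ∑ j : Fin n, V i j * m j = d l i) →
    (∀ l, MvPolynomial.aeval a (g l) = 0) →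
    (∏ l, MvPolynomial.map (algebraMap k K) (g l)) ^ (p - 1) ∉
      Ideal.span (Set.range fun i : Fin n => (MvPolynomial.X i - MvPolynomial.C (a i)) ^ p) := by
  intro p hp n r k _ _ F V hV d g hg K _ _ _ a S hS hSne D hD hcert hface ha
  classical
  have _ := hSne
  have hp0 : p ≠ 0 := hp.out.ne_zero
  -- notation
  set w : Fin n → ℕ := fun j => ∑ i ∈ S, V i j with hw
  set P₀ : Fin r → MvPolynomial (Fin n) k := fun l => weightedHomogeneousComponent w (D l) (F l) with hP₀
  set G : Fin r → MvPolynomial (Fin n) K := fun l => map (algebraMap k K) (g l) with hG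
  set gS : Fin r → MvPolynomial (Fin n) K := fun l =>
    aeval (fun i : Fin n => if i ∈ S then (0 : MvPolynomial (Fin n) K) else X i) (G l) with hgS
  -- (B4) the initial degree of each `F_l` is `Σ_{i∈S} d_l i`, and the chart identity, base-changed to `K`
  have hDeq : ∀ l, D l = ∑ i ∈ S, d l i := fun l =>
    initialDegree_unique w (F l) (hD l) (ToricChartFedder.isInitialDegree_face V hV (F l) (g l) (d l) (hg l) S (hface l))
  have hident : ∀ l, monomial (d l) (1 : K) * gS l =
      aeval (fun j : Fin n => ∏ i : Fin n, (X i : MvPolynomial (Fin n) K) ^ V i j) (map (algebraMap k K) (P₀ l)) := by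
    intro l
    have h := congrArg (map (algebraMap k K))
      (ToricChartFedder.monomial_mul_substZero_eq_theta_component V hV (F l) (g l) (d l) (hg l) S)
    rw [map_mul, map_monomial, map_one, ToricChartFedderAssembly.map_substZero,
      ToricChartFedderAssembly.map_theta, ← hDeq l] at h
    exact h
  -- the product identity `(∏ y^(d_l)) · ∏ g_l(Y_S = 0) = θ (∏ in_S F_l)`
  have hidentProd : (∏ l, monomial (d l) (1 : K)) * ∏ l, gS l =
      aeval (fun j : Fin n => ∏ i : Fin n, (X i : MvPolynomial (Fin n) K) ^ V i j)
        (∏ l, map (algebraMap k K) (P₀ l)) := by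
    rw [← Finset.prod_mul_distrib, map_prod]
    exact Finset.prod_congr rfl fun l _ => hident l
  -- the torus point `ã` and its image `b`
  set at' : Fin n → K := fun i => if i ∈ S then (1 : K) else a i with hat
  have hat0 : ∀ i, at' i ≠ 0 := fun i => by
    by_cases hi : i ∈ S
    · rw [hat]; simp only [hi, if_true]; exact one_ne_zero
    · rw [hat]; simp only [hi, if_false]; exact fun h => hi ((hS i).mpr h)
  have hb0 : ∀ j, (∏ i : Fin n, at' i ^ V i j) ≠ 0 := fun j =>
    Finset.prod_ne_zero_iff.mpr fun i _ => pow_ne_zero _ (hat0 i)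
  -- `g_l(Y_S = 0)` evaluated at `ã` is `g_l(a) = 0`
  have hsub : (fun i : Fin n => if i ∈ S then (0 : K) else at' i) = a := by
    funext i
    by_cases hi : i ∈ S
    · rw [if_pos hi, ((hS i).mp hi)]
    · rw [if_neg hi, hat]; simp only [hi, if_false]
  have hgS_at : ∀ l, aeval at' (gS l) = 0 := by
    intro l
    rw [hgS]
    dsimp only
    rw [ToricChartFedderAssembly.aeval_substZero, hsub, hG]
    dsimp only
    rw [aeval_map_algebraMap, ha l]
  -- every face polynomial vanishes at `b`
  have hvan : ∀ l, aeval (fun j : Fin n => ∏ i : Fin n, at' i ^ V i j) (P₀ l) = 0 := by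
    intro l
    have h1 : aeval (fun j : Fin n => ∏ i : Fin n, at' i ^ V i j) (map (algebraMap k K) (P₀ l)) = 0 := by
      rw [← ToricChartFedderAssembly.aeval_theta V at', ← hident l, map_mul, hgS_at l, mul_zero]
    rwa [aeval_map_algebraMap] at h1
  -- the CI face certificate at the torus point `b`
  have hfed_b := hcert K (fun j : Fin n => ∏ i : Fin n, at' i ^ V i j) hb0 hvan
  rw [← map_prod] at hfed_b
  -- (B3) transport to `ã`
  have hfed_at := MonomialChartFrobeniusTransport.fedder_monomialChart_of_fedder p V hV at' hat0
    (map (algebraMap k K) (∏ l, P₀ l)) hfed_b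
  rw [map_prod, ← hidentProd] at hfed_at
  -- (B2) remove the monomial factor `∏ y^(d_l)` (non-zero at `ã`)
  haveI := ToricChartFedderAssembly.isMaximal_span_X_sub_C at'
  have hmon : (∏ l, (monomial (d l) (1 : K) : MvPolynomial (Fin n) K)) ∉
      Ideal.span (Set.range fun i : Fin n => X i - C (at' i)) := by
    intro hmem
    have hz : aeval at' (∏ l, (monomial (d l) (1 : K) : MvPolynomial (Fin n) K)) = 0 := by
      have hle : Ideal.span (Set.range fun i : Fin n => X i - C (at' i)) ≤
          RingHom.ker (aeval at' : MvPolynomial (Fin n) K →ₐ[K] K).toRingHom := by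
        rw [Ideal.span_le]
        rintro _ ⟨i, rfl⟩
        rw [SetLike.mem_coe, RingHom.mem_ker]
        change aeval at' (X i - C (at' i)) = 0
        rw [map_sub, aeval_X, aeval_C, Algebra.algebraMap_self, RingHom.id_apply, sub_self]
      exact hle hmem
    rw [map_prod] at hz
    refine Finset.prod_ne_zero_iff.mpr (fun l _ => ?_) hz
    rw [aeval_monomial, Algebra.algebraMap_self, RingHom.id_apply, one_mul,
      Finsupp.prod_fintype _ _ (fun i => by simp)]
    exact Finset.prod_ne_zero_iff.mpr (fun i _ => pow_ne_zero _ (hat0 i))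
  have hfed_gS_at : (∏ l, gS l) ^ (p - 1) ∉ Ideal.span (Set.range fun i : Fin n => (X i - C (at' i)) ^ p) :=
    fun hmem => hfed_at ((FedderPointReductions.mul_pow_mem_frobeniusSpan_iff p hp0 at' _ rfl
      (∏ l, (monomial (d l) (1 : K) : MvPolynomial (Fin n) K)) (∏ l, gS l) hmon (p - 1)).mpr hmem)
  -- (B1) from `ã` to `a` (the `S`-coordinates do not occur in `∏ g_l(Y_S = 0)`), then lift to `∏ g_l`
  have hφa : (fun i : Fin n => if i ∈ S then C (a i) else (X i : MvPolynomial (Fin n) K)) =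
      fun i : Fin n => if i ∈ S then (0 : MvPolynomial (Fin n) K) else X i := by
    funext i
    by_cases hi : i ∈ S
    · rw [if_pos hi, if_pos hi, (hS i).mp hi, map_zero]
    · rw [if_neg hi, if_neg hi]
  have hfixl : ∀ l, aeval (fun i : Fin n => if i ∈ S then C (a i) else (X i : MvPolynomial (Fin n) K)) (gS l) = gS l := by
    intro l
    rw [hφa, hgS]
    dsimp only
    rw [← AlgHom.comp_apply, comp_aeval]
    have h : (fun i : Fin n => aeval (fun i : Fin n => if i ∈ S then (0 : MvPolynomial (Fin n) K) else X i)
        (if i ∈ S then (0 : MvPolynomial (Fin n) K) else X i)) =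
        fun i : Fin n => if i ∈ S then (0 : MvPolynomial (Fin n) K) else X i := by
      funext i
      by_cases hi : i ∈ S
      · simp only [hi, if_true, map_zero]
      · simp only [hi, if_false, aeval_X]
    rw [h]
  have hfix : aeval (fun i : Fin n => if i ∈ S then C (a i) else (X i : MvPolynomial (Fin n) K)) (∏ l, gS l) =
      ∏ l, gS l := by
    rw [map_prod]
    exact Finset.prod_congr rfl fun l _ => hfixl l
  have hfed_gS_a : (∏ l, gS l) ^ (p - 1) ∉ Ideal.span (Set.range fun i : Fin n => (X i - C (a i)) ^ p) :=
    fun hmem => hfed_gS_at (FedderPointReductions.pow_mem_frobeniusSpan_of_subst p hp0 S a a at' (fun _ _ => rfl)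
      (fun i hi => by rw [hat]; simp only [hi, if_false]) (∏ l, gS l) (p - 1) hfix hmem)
  refine FedderPointReductions.faceFedder_lift_finset p hp0 S a (∏ l, G l) (p - 1) ?_
  have hprod : aeval (fun i : Fin n => if i ∈ S then C (a i) else (X i : MvPolynomial (Fin n) K)) (∏ l, G l) =
      ∏ l, gS l := by
    rw [map_prod, hφa]
  rw [hprod]
  exact hfed_gS_a

end Summit.ResolutionOfSingularities.ResolutionOfSingularities.Theorems.FInjectiveMacaulayfication.CIToricChartFedder

end
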